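import Summits.CriticalPhenomena.PercolationContinuityZ3.Theorems.SoloInformedNoCriticalBackbone
import Literature.Probability.Percolation.UniquenessInfiniteCluster
import Literature.Probability.Percolation.InequalitiesProofs
import Literature.Probability.Percolation.TwoEdgeDisjointPaths
import Mathlib.Combinatorics.SimpleGraph.Connectivity.EdgeConnectivity
import HarnessLib

/-!
# The backbone two-point function in a jump world (solo seat `solo-CriticalPhenomena-informed`, S17 (c4′))

Write `x ⇉ y` for "`x` and `y` are 2-edge-connected in the open graph" (Mathlib's
`SimpleGraph.IsEdgeReachable 2`; by Menger's theorem, `isEdgeReachable_two_iff` of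
`TwoEdgeDisjointPaths.lean`, this is "two edge-disjoint open paths from `x` to `y`", and it implies
the disjoint occurrence `{x ↔ y} □ {x ↔ y}`). The event `robust v` of
`SoloInformedHangingBridges.lean` (`C(v)` infinite and still infinite after closing any single edge)
is increasing and measurable, so for Bernoulli bond percolation on `ℤ^d` with `p < 1`:

* Harris–FKG and translation invariance give `P_p(0 robust)² ≤ P_p(0 robust ∧ x robust)`;
* almost surely, for ALL edges `e` simultaneously, the configuration `ω ∖ e` has at most one
  infinite cluster (Aizenman–Kesten–Newman / Burton–Keane uniqueness pulled back along the one-edge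
  closing map by deletion tolerance, `ae_forall_numInfiniteClusters_sdiff_le_one`);
* hence on `{0 robust ∧ x robust}` the infinite clusters of `0` and `x` in `ω ∖ e` coincide for every
  `e`, i.e. no single edge separates `0` from `x`: `0 ⇉ x` (`isEdgeReachable_two_of_mem_robust`).

Conclusion (`sq_measureReal_robust_le_twoEdgeConn`): **`P_p(0 robust)² ≤ P_p(0 ⇉ x)` for every
`x ∈ ℤ^d`** (and `≤ P_p({0 ↔ x} □ {0 ↔ x})`). Combined with the jump-world dichotomy of
`SoloInformedNoCriticalBackbone.lean` this gives, at `p_c(ℤ^d)`, `d ≥ 2`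
(`jumpWorld_backbone_dichotomy`, `…_Z3`): if `θ(p_c) > 0` then EITHER the finite-cluster
susceptibility `Σ_a P_{p_c}(a ∈ C(0), |C(0)| < ∞)` diverges OR the critical BACKBONE two-point
function is bounded below, `inf_x P_{p_c}(0 ⇉ x) > 0`. Contrapositive
(`percolationContinuity_of_backbone_decay`): `inf_x P_{p_c}(0 ⇉ x) = 0` together with a finite
finite-cluster susceptibility at `p_c` implies `θ(p_c) = 0`. Decay of the backbone two-point function
is a consequence of `θ(p_c) = 0` with disjoint-occurrence structure (BK bounds it by `τ_{p_c}(0,x)²`,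
`real_setOf_isEdgeReachable_two_le`); it is not known to be equivalent to the decay of `τ_{p_c}`
itself, which is the target. [folklore]

Tree anchors: `harris_fkg_holds` (Harris–FKG), `Grimmett1999_numInfiniteClusters_le_one_holds`
(uniqueness), `numInfiniteClusters_le_one_iff`, `measure_preimage_closeEdges_singleton_le`
(deletion tolerance), `measureReal_robust_eq` (translation invariance), `jumpWorld_dichotomy`,
`mem_disjointOccurrence_openConn_of_isEdgeReachable_two`; Mathlib `SimpleGraph.isEdgeReachable_two`,
`MeasureTheory.ae_all_iff`, `exists_measurable_superset_of_null`.
-/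

noncomputable section

namespace Summit.CriticalPhenomena.PercolationContinuityZ3.Theorems

open Literature.Probability.Percolation SimpleGraph MeasureTheory Filter Topology
open scoped ENNReal

variable {V : Type*}

/-! ### Deterministic part -/

/-- The event `x ⇉ y`: `x, y` are 2-edge-connected in the open graph (equivalently, by Menger,
joined by two edge-disjoint open paths). [folklore] -/
def twoEdgeConn (x y : V) : Set (BondConfig V) :=
  {ω | (openGraph ω).IsEdgeReachable 2 x y}

/-- Membership in `twoEdgeConn`, unfolded. [folklore] -/
theorem mem_twoEdgeConn_iff {ω : BondConfig V} {x y : V} :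
    ω ∈ twoEdgeConn x y ↔ (openGraph ω).IsEdgeReachable 2 x y := Iff.rfl

/-- Closing the edge `e` deletes it from the open graph. [folklore] -/
theorem openGraph_sdiff_singleton (ω : BondConfig V) (e : Sym2 V) :
    openGraph (ω \ {e}) = (openGraph ω).deleteEdges {e} := by
  ext x y
  simp only [openGraph_adj, deleteEdges_adj, Set.mem_sdiff, Set.mem_singleton_iff]
  tauto

/-- `x ⇉ y` implies the disjoint occurrence `{x ↔ y} □ {x ↔ y}` (tree, via Menger). [folklore] -/
theorem twoEdgeConn_subset_disjointOccurrence (x y : V) :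
    twoEdgeConn x y ⊆ openConn x y □ openConn x y :=
  fun _ hω => mem_disjointOccurrence_openConn_of_isEdgeReachable_two hω

/-- **Two robust vertices are 2-edge-connected** as soon as every one-edge deletion of the
configuration has at most one infinite cluster: for each edge `e` both `C_{ω∖e}(x)` and `C_{ω∖e}(y)`
are infinite, hence equal, so `x ↔ y` off `e`. [folklore] -/
theorem isEdgeReachable_two_of_mem_robust {ω : BondConfig V} {x y : V}
    (huniq : ∀ e : Sym2 V, numInfiniteClusters (ω \ {e}) ≤ 1) (hx : ω ∈ robust x)
    (hy : ω ∈ robust y) : (openGraph ω).IsEdgeReachable 2 x y := by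
  rw [isEdgeReachable_two]
  intro e
  rw [← openGraph_sdiff_singleton]
  exact (numInfiniteClusters_le_one_iff _).1 (huniq e) x y (hx.2 e) (hy.2 e)

/-- `robust v` is an increasing event. [folklore] -/
theorem isUpperSet_robust (v : V) : IsUpperSet (robust v) :=
  fun _ _ h hω => robust_mono h v hω

/-- `robust v = {|C(v)| = ∞} ∩ ⋂_{a,b} (close `s(a,b)`)⁻¹ {|C(v)| = ∞}`. [folklore] -/
theorem robust_eq_inter_iInter (v : V) :
    robust v = percolatesAt v ∩ ⋂ ab : V × V, closeEdges {s(ab.1, ab.2)} ⁻¹' percolatesAt v := by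
  ext ω
  simp only [robust, Set.mem_setOf_eq, Set.mem_inter_iff, Set.mem_iInter, Set.mem_preimage,
    percolatesAt, closeEdges]
  refine and_congr Iff.rfl ⟨fun h ab => h _, fun h e => ?_⟩
  induction e using Sym2.ind with
  | h a b => exact h (a, b)

/-- `robust v` is measurable. [folklore] -/
theorem measurableSet_robust [Countable V] (v : V) : MeasurableSet (robust (V := V) v) := by
  rw [robust_eq_inter_iInter]
  exact (measurableSet_percolatesAt_holds v).inter
    (MeasurableSet.iInter fun ab => measurable_closeEdges _ (measurableSet_percolatesAt_holds v))

/-- Monotonicity of a finite measure under an almost-sure inclusion, real-valued form. [folklore] -/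
private theorem measureReal_mono_ae'' {α : Type*} [MeasurableSpace α] {μ : Measure α}
    [IsFiniteMeasure μ] {s t : Set α} (h : ∀ᵐ x ∂μ, x ∈ s → x ∈ t) : μ.real s ≤ μ.real t := by
  simp only [measureReal_def]
  exact ENNReal.toReal_mono (measure_ne_top μ t) (measure_mono_ae h)

/-! ### `ℤ^d` -/

section Zd

open Literature.Probability.LatticeModels

variable {d : ℕ}

/-- **Uniqueness survives every one-edge deletion, simultaneously**: for `p < 1`, `P_p`-a.s., for
all `e`, `ω ∖ e` has at most one infinite cluster (the `P_p`-null event "at least two infinite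
clusters" pulls back to a null event under the closing map `ω ↦ ω ∖ e`, by deletion tolerance).
[folklore] -/
theorem ae_forall_numInfiniteClusters_sdiff_le_one (p : unitInterval) (hp : (p : ℝ) < 1) :
    ∀ᵐ ω ∂(bondPercolation (zdGraph d) p), ∀ e : Sym2 (Site d), numInfiniteClusters (ω \ {e}) ≤ 1 := by
  set μ := bondPercolation (zdGraph d) p with hμ
  have hnull : μ {ω | ¬ numInfiniteClusters ω ≤ 1} = 0 := by
    have h := Grimmett1999_numInfiniteClusters_le_one_holds d p
    rw [ae_iff] at h
    exact h
  obtain ⟨t, hst, htm, ht0⟩ := exists_measurable_superset_of_null hnull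
  have hpre : ∀ e : Sym2 (Site d), μ (closeEdges {e} ⁻¹' t) = 0 := by
    intro e
    have h := measure_preimage_closeEdges_singleton_le (zdGraph d) p hp e htm
    rw [ht0, mul_zero] at h
    exact le_antisymm h bot_le
  have hall : ∀ ab : Site d × Site d, ∀ᵐ ω ∂μ, numInfiniteClusters (ω \ {s(ab.1, ab.2)}) ≤ 1 := by
    intro ab
    rw [ae_iff]
    refine measure_mono_null (fun ω hω => ?_) (hpre s(ab.1, ab.2))
    exact hst hω
  have hall' := ae_all_iff.2 hall
  filter_upwards [hall'] with ω hω e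
  induction e using Sym2.ind with
  | h a b => exact hω (a, b)

/-- **The backbone two-point lower bound**: for `p < 1` and every `x ∈ ℤ^d`,
`P_p(0 robust)² ≤ P_p(0 ⇉ x)`. [folklore] -/
theorem sq_measureReal_robust_le_twoEdgeConn (p : unitInterval) (hp : (p : ℝ) < 1) (x : Site d) :
    (bondPercolation (zdGraph d) p).real (robust (0 : Site d)) ^ 2 ≤
      (bondPercolation (zdGraph d) p).real (twoEdgeConn (0 : Site d) x) := by
  set μ := bondPercolation (zdGraph d) p with hμ
  have hH : μ.real (robust (0 : Site d)) * μ.real (robust x) ≤ μ.real (robust 0 ∩ robust x) :=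
    harris_fkg_holds (zdGraph d) p (isUpperSet_robust 0) (isUpperSet_robust x)
      (measurableSet_robust 0) (measurableSet_robust x)
  have hae : ∀ᵐ ω ∂μ, ω ∈ robust (0 : Site d) ∩ robust x → ω ∈ twoEdgeConn (0 : Site d) x := by
    filter_upwards [ae_forall_numInfiniteClusters_sdiff_le_one (d := d) p hp] with ω huniq hω
    exact isEdgeReachable_two_of_mem_robust huniq hω.1 hω.2
  calc μ.real (robust (0 : Site d)) ^ 2 = μ.real (robust (0 : Site d)) * μ.real (robust x) := by
        rw [sq, measureReal_robust_eq p x]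
    _ ≤ μ.real (robust 0 ∩ robust x) := hH
    _ ≤ μ.real (twoEdgeConn 0 x) := measureReal_mono_ae'' hae

/-- Disjoint-occurrence form: `P_p(0 robust)² ≤ P_p({0 ↔ x} □ {0 ↔ x})`. [folklore] -/
theorem sq_measureReal_robust_le_disjointOccurrence (p : unitInterval) (hp : (p : ℝ) < 1)
    (x : Site d) :
    (bondPercolation (zdGraph d) p).real (robust (0 : Site d)) ^ 2 ≤
      (bondPercolation (zdGraph d) p).real (openConn (0 : Site d) x □ openConn (0 : Site d) x) :=
  (sq_measureReal_robust_le_twoEdgeConn p hp x).trans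
    (measureReal_mono (twoEdgeConn_subset_disjointOccurrence 0 x))

/-- **Jump-world backbone dichotomy at `p_c(ℤ^d)`, `d ≥ 2`.** If `θ(p_c) > 0` then either the
finite-cluster susceptibility diverges at `p_c`, or the critical backbone two-point function is
bounded below uniformly in `x`. [folklore] -/
theorem jumpWorld_backbone_dichotomy (hd : 2 ≤ d) (h : ¬ PercolationContinuity d) :
    (¬ Summable fun a : Site d =>
        (bondPercolation (zdGraph d) (criticalProbI d)).real (finConn (0 : Site d) a)) ∨
      ∃ c : ℝ, 0 < c ∧ ∀ x : Site d,
        c ≤ (bondPercolation (zdGraph d) (criticalProbI d)).real (twoEdgeConn (0 : Site d) x) := by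
  rcases jumpWorld_dichotomy hd h with hns | hpos
  · exact Or.inl hns
  · refine Or.inr ⟨_, pow_pos hpos 2, fun x => ?_⟩
    have hpc1 : ((criticalProbI d : unitInterval) : ℝ) < 1 := by
      rw [coe_criticalProbI]; exact criticalProb_zd_lt_one hd
    exact sq_measureReal_robust_le_twoEdgeConn (criticalProbI d) hpc1 x

/-- **Backbone decay plus thin finite clusters imply continuity** (`d ≥ 2`): if
`inf_x P_{p_c}(0 ⇉ x) = 0` and `Σ_a P_{p_c}(a ∈ C(0), |C(0)| < ∞) < ∞` then `θ(p_c) = 0`. [folklore] -/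
theorem percolationContinuity_of_backbone_decay (hd : 2 ≤ d)
    (hdecay : ∀ ε : ℝ, 0 < ε → ∃ x : Site d,
      (bondPercolation (zdGraph d) (criticalProbI d)).real (twoEdgeConn (0 : Site d) x) < ε)
    (hχ : Summable fun a : Site d =>
      (bondPercolation (zdGraph d) (criticalProbI d)).real (finConn (0 : Site d) a)) :
    PercolationContinuity d := by
  by_contra h
  rcases jumpWorld_backbone_dichotomy hd h with hns | ⟨c, hc, hcx⟩
  · exact hns hχ
  · obtain ⟨x, hx⟩ := hdecay c hc
    exact (not_lt.2 (hcx x)) hx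

/-- The case `d = 3`: `¬ PercolationContinuityZ3` forces `χᶠ(p_c) = ∞` or a uniformly positive
critical backbone two-point function. [folklore] -/
theorem jumpWorld_backbone_dichotomy_Z3 (h : ¬ PercolationContinuityZ3) :
    (¬ Summable fun a : Site 3 =>
        (bondPercolation (zdGraph 3) (criticalProbI 3)).real (finConn (0 : Site 3) a)) ∨
      ∃ c : ℝ, 0 < c ∧ ∀ x : Site 3,
        c ≤ (bondPercolation (zdGraph 3) (criticalProbI 3)).real (twoEdgeConn (0 : Site 3) x) :=
  jumpWorld_backbone_dichotomy (by norm_num) h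

/-- The case `d = 3` of `percolationContinuity_of_backbone_decay`. [folklore] -/
theorem percolationContinuityZ3_of_backbone_decay
    (hdecay : ∀ ε : ℝ, 0 < ε → ∃ x : Site 3,
      (bondPercolation (zdGraph 3) (criticalProbI 3)).real (twoEdgeConn (0 : Site 3) x) < ε)
    (hχ : Summable fun a : Site 3 =>
      (bondPercolation (zdGraph 3) (criticalProbI 3)).real (finConn (0 : Site 3) a)) :
    PercolationContinuityZ3 :=
  percolationContinuity_of_backbone_decay (by norm_num) hdecay hχ

end Zd

end Summit.CriticalPhenomena.PercolationContinuityZ3.Theorems
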